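import Summits.KontsevichZagierPeriods.KontsevichZagierPeriods.Theorems.RootDecompRationalCubeDichotomyLogFibreP2
import Summits.KontsevichZagierPeriods.KontsevichZagierPeriods.Theorems.RootDecompRationalCubeDichotomyArctanFibreP1

/-!
# Log-fibre calculus for `RationalCubePiKernelSingle` (route `RootDecompRationalCubeDichotomy`, crux stmt-KontsevichZagierPeriods-26322) at `m = 2` · part 3/4

Cell `decomp-kz`, lens 2 (decomp-kz-lens-2 g6): the LOG-FIBRE SECTOR `Λ[E] = [[0,1]², E(y)/(1 + x·y·E(y))]`
(`E ∈ ℚ(y)` regular, `≥ 0`) is closed under the moves by RULE (2) ONLY — product rule `lam_mul`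
(`Λ[E₁+E₂+yE₁E₂] ≡ Λ[E₁] + Λ[E₂]`, a fibred chart) and power rule `lam_pow`; inside it the whole `π²`-class of the
cell's weight-2 census (`census₂ … census₆`, 15/15 pairs) and the route's `EulerInstance`
(`euler_rel : 3•[□,1/(1+xy)] − 4•[□,1/((1+x²)(1+y²))] ∈ KZ.relations`) are DECIDED with `N = 0`, and
`single_inst₂ … single_inst₆`, `single_instEuler` are the corresponding LITERAL instances of the binder list of
`RationalCubePiKernelSingle` at `m = 2` (the route decl is not referenced by name, so these modules do not import
the route file).

Source: `HOME/decomp-kz-lens-2/g6/LogFibreCalculus.lean` sha256 73bd8b5e80afc467 (1113 l; critic decomp-kz-crit-1 g2 CLEARED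
2026-08-30T08:00:40Z incl. the binder check, std axioms), split into 4 modules by the landing seat decomp-kz-census-1 g7
(contexts re-opened per part; generic docstrings added where the source had none).  No `sorry`; standard axioms.
References: [cite: KontsevichZagier2001, §1.2].
-/

noncomputable section
open Set MeasureTheory MvPolynomial
open Literature.ModelTheory.ExponentialFields (IsSemialgebraic)
open Literature.NumberTheory.Transcendental
open Literature.NumberTheory.Transcendental.KZ
open Literature.NumberTheory.Transcendental.KZ.RFun
open Summit.KontsevichZagierPeriods.KontsevichZagierPeriods.Theorems

namespace Summit.KontsevichZagierPeriods.RootDecompRationalCubeDichotomy.LogFibre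

-- shared generalities landed first in the arctan-fibre module (dedup.landed): reuse them
open Summit.KontsevichZagierPeriods.RootDecompRationalCubeDichotomy.ArctanFibre (pi_univ_Icc_eq_cube single_of_rel)

section Census

/-- `m1`: `(y+y³) ⊞ 1 = 1+y+y²+y³+y⁴` (`E₁ ⊞ E₂ := E₁ + E₂ + yE₁E₂`; `(1+y²+y⁴)(1+y)`). -/
theorem m1 : KZ.of lT1.rep - KZ.of lYY3.rep - KZ.of lOne.rep ∈ KZ.relations :=
  lam_mul eYY3_nn eOne_nn (fun t ht => by have := ht.1; simp; positivity) eT1_nn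
    fun t _ => by simp only [ev_eT1, ev_eYY3, ev_eOne]; ring
/-- `m2`: `(1+y) ⊞ y² = 1+y+y²+y³+y⁴` (`(1+y+y²)(1+y³)`). -/
theorem m2 : KZ.of lT1.rep - KZ.of l1Y.rep - KZ.of lYsq.rep ∈ KZ.relations :=
  lam_mul e1Y_nn eYsq_nn (fun t ht => by have := ht.1; simp; positivity) eT1_nn
    fun t _ => by simp only [ev_eT1, ev_e1Y, ev_eYsq]; ring
/-- `m3`: `1/(1+y²) ⊞ y = 1 + y` (`R₅ Φ₄ = Φ₃`). -/
theorem m3 : KZ.of l1Y.rep - KZ.of lR5.rep - KZ.of lY.rep ∈ KZ.relations :=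
  lam_mul eR5_nn eY_nn (fun t ht => by have := ht.1; simp; positivity) e1Y_nn
    fun t _ => by
      have h : (1 : ℝ) + t ^ 2 ≠ 0 := by positivity
      simp only [ev_e1Y, ev_eR5, ev_eY]; field_simp; ring
/-- `m4`: `1/(1+y+y²) ⊞ (1+y) = 2 + y` (`R₆ Φ₃ = Φ₂²`). -/
theorem m4 : KZ.of l2Y.rep - KZ.of lR6.rep - KZ.of l1Y.rep ∈ KZ.relations :=
  lam_mul eR6_nn e1Y_nn (fun t ht => by have := ht.1; simp; positivity) e2Y_nn
    fun t ht => by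
      have h0 := ht.1
      have h : (1 : ℝ) + t + t ^ 2 ≠ 0 := by positivity
      simp only [ev_e2Y, ev_eR6, ev_e1Y]; field_simp; ring
/-- `m4'`: `1 ⊞ 1 = 2 + y` (`Φ₂ Φ₂ = Φ₂²`). -/
theorem m4' : KZ.of l2Y.rep - KZ.of lOne.rep - KZ.of lOne.rep ∈ KZ.relations :=
  lam_mul eOne_nn eOne_nn (fun t _ => by simp) e2Y_nn
    fun t _ => by simp only [ev_e2Y, ev_eOne]; ring
/-- `m5`: `2/(1+y²) ⊞ y = 2 + y` (`R₄ Φ₄ = Φ₂²`). -/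
theorem m5 : KZ.of l2Y.rep - KZ.of lR4.rep - KZ.of lY.rep ∈ KZ.relations :=
  lam_mul eR4_nn eY_nn (fun t ht => by have := ht.1; simp; positivity) e2Y_nn
    fun t _ => by
      have h : (1 : ℝ) + t ^ 2 ≠ 0 := by positivity
      simp only [ev_e2Y, ev_eR4, ev_eY]; field_simp; ring
/-- `m6`: `1/(1-y+y²) ⊞ y² = 1 + y + y²` (`R₃ (1+y³) = Φ₄ Φ₂`). -/
theorem m6 : KZ.of l1YY2.rep - KZ.of lR3.rep - KZ.of lYsq.rep ∈ KZ.relations :=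
  lam_mul eR3_nn eYsq_nn
    (fun t _ => by simp only [ev_eR3, ev_eYsq]; have := quad3_pos t; positivity) e1YY2_nn
    fun t _ => by
      have h : (1 : ℝ) - t + t ^ 2 ≠ 0 := (quad3_pos t).ne'
      simp only [ev_e1YY2, ev_eR3, ev_eYsq]; field_simp; ring
/-- `m6'`: `y ⊞ 1 = 1 + y + y²` (`(1+y²)(1+y)`). -/
theorem m6' : KZ.of l1YY2.rep - KZ.of lY.rep - KZ.of lOne.rep ∈ KZ.relations :=
  lam_mul eY_nn eOne_nn (fun t ht => by have := ht.1; simp; positivity) e1YY2_nn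
    fun t _ => by simp only [ev_e1YY2, ev_eY, ev_eOne]; ring
/-- `m7`: `2/(1-y+y²) ⊞ y² = 2 + 2y + y²` (`R₂ (1+y³) = Φ₃ Φ₂`). -/
theorem m7 : KZ.of l22YY2.rep - KZ.of lR2.rep - KZ.of lYsq.rep ∈ KZ.relations :=
  lam_mul eR2_nn eYsq_nn
    (fun t _ => by simp only [ev_eR2, ev_eYsq]; have := quad3_pos t; positivity) e22YY2_nn
    fun t _ => by
      have h : (1 : ℝ) - t + t ^ 2 ≠ 0 := (quad3_pos t).ne'
      simp only [ev_e22YY2, ev_eR2, ev_eYsq]; field_simp; ring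
/-- `m7'`: `(1+y) ⊞ 1 = 2 + 2y + y²` (`Φ₃ Φ₂`). -/
theorem m7' : KZ.of l22YY2.rep - KZ.of l1Y.rep - KZ.of lOne.rep ∈ KZ.relations :=
  lam_mul e1Y_nn eOne_nn (fun t ht => by have := ht.1; simp; positivity) e22YY2_nn
    fun t _ => by simp only [ev_e22YY2, ev_e1Y, ev_eOne]; ring

/-! ### The census representations `[□, 1/Qᵢ]` and their links to the `Λ`'s -/

/-- `QB_ne`: auxiliary theorem of the log-fibre calculus for `RationalCubePiKernelSingle` (stmt-26322) — see the module docstring; verbatim from the lens-2 g6 file. -/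
theorem QB_ne : ∀ z ∈ KZ.cube 2, aeval z (1 + X 1 * X 0 : MvPolynomial (Fin 2) ℚ) ≠ 0 := by
  intro z hz
  obtain ⟨⟨hy0, -⟩, hx0, -⟩ := mem_cube_two hz
  simp only [map_add, map_one, map_mul, aeval_X]
  positivity
/-- `Q2_ne`: auxiliary theorem of the log-fibre calculus for `RationalCubePiKernelSingle` (stmt-26322) — see the module docstring; verbatim from the lens-2 g6 file. -/
theorem Q2_ne : ∀ z ∈ KZ.cube 2,
    aeval z (1 - X 0 + X 0 ^ 2 + 2 * X 1 * X 0 : MvPolynomial (Fin 2) ℚ) ≠ 0 := by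
  intro z hz
  obtain ⟨⟨hy0, -⟩, hx0, -⟩ := mem_cube_two hz
  simp only [map_add, map_sub, map_one, map_mul, map_pow, map_ofNat, aeval_X]
  have := quad3_pos (z 0)
  have := mul_nonneg hx0 hy0
  exact (by nlinarith : (0 : ℝ) < 1 - z 0 + z 0 ^ 2 + 2 * z 1 * z 0).ne'
/-- `Q3_ne`: auxiliary theorem of the log-fibre calculus for `RationalCubePiKernelSingle` (stmt-26322) — see the module docstring; verbatim from the lens-2 g6 file. -/
theorem Q3_ne : ∀ z ∈ KZ.cube 2,
    aeval z (1 - X 0 + X 0 ^ 2 + X 1 * X 0 : MvPolynomial (Fin 2) ℚ) ≠ 0 := by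
  intro z hz
  obtain ⟨⟨hy0, -⟩, hx0, -⟩ := mem_cube_two hz
  simp only [map_add, map_sub, map_one, map_mul, map_pow, aeval_X]
  have := quad3_pos (z 0)
  have := mul_nonneg hx0 hy0
  exact (by nlinarith : (0 : ℝ) < 1 - z 0 + z 0 ^ 2 + z 1 * z 0).ne'
/-- `Q4_ne`: auxiliary theorem of the log-fibre calculus for `RationalCubePiKernelSingle` (stmt-26322) — see the module docstring; verbatim from the lens-2 g6 file. -/
theorem Q4_ne : ∀ z ∈ KZ.cube 2,
    aeval z (1 + X 0 ^ 2 + 2 * X 1 * X 0 : MvPolynomial (Fin 2) ℚ) ≠ 0 := by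
  intro z hz
  obtain ⟨⟨hy0, -⟩, hx0, -⟩ := mem_cube_two hz
  simp only [map_add, map_one, map_mul, map_pow, map_ofNat, aeval_X]
  positivity
/-- `Q5_ne`: auxiliary theorem of the log-fibre calculus for `RationalCubePiKernelSingle` (stmt-26322) — see the module docstring; verbatim from the lens-2 g6 file. -/
theorem Q5_ne : ∀ z ∈ KZ.cube 2,
    aeval z (1 + X 0 ^ 2 + X 1 * X 0 : MvPolynomial (Fin 2) ℚ) ≠ 0 := by
  intro z hz
  obtain ⟨⟨hy0, -⟩, hx0, -⟩ := mem_cube_two hz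
  simp only [map_add, map_one, map_mul, map_pow, aeval_X]
  positivity
/-- `Q6_ne`: auxiliary theorem of the log-fibre calculus for `RationalCubePiKernelSingle` (stmt-26322) — see the module docstring; verbatim from the lens-2 g6 file. -/
theorem Q6_ne : ∀ z ∈ KZ.cube 2,
    aeval z (1 + X 0 + X 0 ^ 2 + X 1 * X 0 : MvPolynomial (Fin 2) ℚ) ≠ 0 := by
  intro z hz
  obtain ⟨⟨hy0, -⟩, hx0, -⟩ := mem_cube_two hz
  simp only [map_add, map_one, map_mul, map_pow, aeval_X]
  positivity

/-- `B = [□, 1/(1+xy)]` (`= π²/12`). -/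
def cB : RFun 2 := ⟨1, 1 + X 1 * X 0, QB_ne⟩
/-- `[□, 1/(1-y+y²+2xy)]` (census: `= π²/12`). -/
def c2 : RFun 2 := ⟨1, 1 - X 0 + X 0 ^ 2 + 2 * X 1 * X 0, Q2_ne⟩
/-- `[□, 1/(1-y+y²+xy)]` (census: `= 7π²/72`). -/
def c3 : RFun 2 := ⟨1, 1 - X 0 + X 0 ^ 2 + X 1 * X 0, Q3_ne⟩
/-- `[□, 1/(1+y²+2xy)]` (census: `= π²/16`). -/
def c4 : RFun 2 := ⟨1, 1 + X 0 ^ 2 + 2 * X 1 * X 0, Q4_ne⟩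
/-- `[□, 1/(1+y²+xy)]` (census: `= 5π²/72`). -/
def c5 : RFun 2 := ⟨1, 1 + X 0 ^ 2 + X 1 * X 0, Q5_ne⟩
/-- `[□, 1/(1+y+y²+xy)]` (census: `= π²/18`). -/
def c6 : RFun 2 := ⟨1, 1 + X 0 + X 0 ^ 2 + X 1 * X 0, Q6_ne⟩

/-- `lB`: auxiliary theorem of the log-fibre calculus for `RationalCubePiKernelSingle` (stmt-26322) — see the module docstring; verbatim from the lens-2 g6 file. -/
theorem lB : KZ.of cB.rep - KZ.of lOne.rep ∈ KZ.relations :=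
  rel_of_eqOn fun z hz => by
    rw [show lOne = lam eOne eOne_nn from rfl, fn_lam hz, ev_eOne]
    simp [cB, fn_apply]
/-- `l2`: auxiliary theorem of the log-fibre calculus for `RationalCubePiKernelSingle` (stmt-26322) — see the module docstring; verbatim from the lens-2 g6 file. -/
theorem l2 : KZ.of lR2.rep - 2 • KZ.of c2.rep ∈ KZ.relations := by
  have h : KZ.of lR2.rep - KZ.of ((const ((2 : ℕ) : ℚ)).mul c2).rep ∈ KZ.relations :=
    rel_of_eqOn fun z hz => by
      obtain ⟨⟨hy0, -⟩, hx0, -⟩ := mem_cube_two hz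
      have hq : (1 : ℝ) - z 0 + z 0 ^ 2 ≠ 0 := (quad3_pos (z 0)).ne'
      have hQ : (1 : ℝ) - z 0 + z 0 ^ 2 + 2 * z 1 * z 0 ≠ 0 := by
        have := quad3_pos (z 0); have := mul_nonneg hx0 hy0
        exact (by nlinarith : (0 : ℝ) < 1 - z 0 + z 0 ^ 2 + 2 * z 1 * z 0).ne'
      rw [show lR2 = lam eR2 eR2_nn from rfl, fn_lam hz, ev_eR2, fn_mul, fn_const, Rat.cast_natCast,
        Nat.cast_ofNat]
      simp only [c2, fn_apply, map_add, map_sub, map_one, map_mul, map_pow, map_ofNat, aeval_X]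
      field_simp
  convert add_mem h (rel_constMul 2 c2) using 1
  abel
/-- `l3`: auxiliary theorem of the log-fibre calculus for `RationalCubePiKernelSingle` (stmt-26322) — see the module docstring; verbatim from the lens-2 g6 file. -/
theorem l3 : KZ.of c3.rep - KZ.of lR3.rep ∈ KZ.relations :=
  rel_of_eqOn fun z hz => by
    obtain ⟨⟨hy0, -⟩, hx0, -⟩ := mem_cube_two hz
    have hq : (1 : ℝ) - z 0 + z 0 ^ 2 ≠ 0 := (quad3_pos (z 0)).ne'
    have hQ : (1 : ℝ) - z 0 + z 0 ^ 2 + z 1 * z 0 ≠ 0 := by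
      have := quad3_pos (z 0); have := mul_nonneg hx0 hy0
      exact (by nlinarith : (0 : ℝ) < 1 - z 0 + z 0 ^ 2 + z 1 * z 0).ne'
    rw [show lR3 = lam eR3 eR3_nn from rfl, fn_lam hz, ev_eR3]
    simp only [c3, fn_apply, map_add, map_sub, map_one, map_mul, map_pow, aeval_X]
    field_simp
/-- `l4`: auxiliary theorem of the log-fibre calculus for `RationalCubePiKernelSingle` (stmt-26322) — see the module docstring; verbatim from the lens-2 g6 file. -/
theorem l4 : KZ.of lR4.rep - 2 • KZ.of c4.rep ∈ KZ.relations := by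
  have h : KZ.of lR4.rep - KZ.of ((const ((2 : ℕ) : ℚ)).mul c4).rep ∈ KZ.relations :=
    rel_of_eqOn fun z hz => by
      obtain ⟨⟨hy0, -⟩, hx0, -⟩ := mem_cube_two hz
      have hq : (1 : ℝ) + z 0 ^ 2 ≠ 0 := by positivity
      have hQ : (1 : ℝ) + z 0 ^ 2 + 2 * z 1 * z 0 ≠ 0 := by positivity
      rw [show lR4 = lam eR4 eR4_nn from rfl, fn_lam hz, ev_eR4, fn_mul, fn_const, Rat.cast_natCast,
        Nat.cast_ofNat]
      simp only [c4, fn_apply, map_add, map_one, map_mul, map_pow, map_ofNat, aeval_X]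
      field_simp
  convert add_mem h (rel_constMul 2 c4) using 1
  abel
/-- `l5`: auxiliary theorem of the log-fibre calculus for `RationalCubePiKernelSingle` (stmt-26322) — see the module docstring; verbatim from the lens-2 g6 file. -/
theorem l5 : KZ.of c5.rep - KZ.of lR5.rep ∈ KZ.relations :=
  rel_of_eqOn fun z hz => by
    obtain ⟨⟨hy0, -⟩, hx0, -⟩ := mem_cube_two hz
    have hq : (1 : ℝ) + z 0 ^ 2 ≠ 0 := by positivity
    have hQ : (1 : ℝ) + z 0 ^ 2 + z 1 * z 0 ≠ 0 := by positivity
    rw [show lR5 = lam eR5 eR5_nn from rfl, fn_lam hz, ev_eR5]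
    simp only [c5, fn_apply, map_add, map_one, map_mul, map_pow, aeval_X]
    field_simp
/-- `l6`: auxiliary theorem of the log-fibre calculus for `RationalCubePiKernelSingle` (stmt-26322) — see the module docstring; verbatim from the lens-2 g6 file. -/
theorem l6 : KZ.of c6.rep - KZ.of lR6.rep ∈ KZ.relations :=
  rel_of_eqOn fun z hz => by
    obtain ⟨⟨hy0, -⟩, hx0, -⟩ := mem_cube_two hz
    have hq : (1 : ℝ) + z 0 + z 0 ^ 2 ≠ 0 := by positivity
    have hQ : (1 : ℝ) + z 0 + z 0 ^ 2 + z 1 * z 0 ≠ 0 := by positivity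
    rw [show lR6 = lam eR6 eR6_nn from rfl, fn_lam hz, ev_eR6]
    simp only [c6, fn_apply, map_add, map_one, map_mul, map_pow, aeval_X]
    field_simp

/-! ### The integer certificates -/

/-- `[□, 1/(1-y+y²+2xy)] ≡ [□, 1/(1+xy)]` (`= π²/12`):
`Λ[2/(1-y+y²)] - 2Λ[1] = -m7 + m7' - 2 m2 + 2 m1 - w3 + w2`, then halving (torsion-freeness of
`P_KZ`, `SoloBlind.mem_relations_of_nsmul_mem`). -/
theorem census₂ : KZ.of c2.rep - KZ.of cB.rep ∈ KZ.relations := by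
  have hX : KZ.of lR2.rep - 2 • KZ.of lOne.rep ∈ KZ.relations := by
    have h := add_mem (sub_mem (add_mem (sub_mem (sub_mem m7' m7) (nsmul_mem m2 2))
      (nsmul_mem m1 2)) w3) w2
    convert h using 1
    abel
  have h2 : 2 • (KZ.of c2.rep - KZ.of cB.rep) ∈ KZ.relations := by
    convert sub_mem (sub_mem hX l2) (nsmul_mem lB 2) using 1
    abel
  exact SoloBlind.mem_relations_of_nsmul_mem two_ne_zero h2

/-- `6•[□, 1/(1-y+y²+xy)] ≡ 7•[□, 1/(1+xy)]` (`7π²/72`):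
`6Λ[1/(1-y+y²)] - 7Λ[1] = -6 m6 + 6 m6' - 3 w1 + 2 w2`. -/
theorem census₃ : 6 • KZ.of c3.rep - 7 • KZ.of cB.rep ∈ KZ.relations := by
  have hX : 6 • KZ.of lR3.rep - 7 • KZ.of lOne.rep ∈ KZ.relations := by
    have h := add_mem (sub_mem (sub_mem (nsmul_mem m6' 6) (nsmul_mem m6 6)) (nsmul_mem w1 3))
      (nsmul_mem w2 2)
    convert h using 1
    abel
  convert sub_mem (add_mem (nsmul_mem l3 6) hX) (nsmul_mem lB 7) using 1
  abel

/-- `4•[□, 1/(1+y²+2xy)] ≡ 3•[□, 1/(1+xy)]` (`π²/16`):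
`2Λ[2/(1+y²)] - 3Λ[1] = -2 m5 + 2 m4' + w1`. -/
theorem census₄ : 4 • KZ.of c4.rep - 3 • KZ.of cB.rep ∈ KZ.relations := by
  have hX : 2 • KZ.of lR4.rep - 3 • KZ.of lOne.rep ∈ KZ.relations := by
    have h := add_mem (sub_mem (nsmul_mem m4' 2) (nsmul_mem m5 2)) w1
    convert h using 1
    abel
  convert sub_mem (sub_mem hX (nsmul_mem l4 2)) (nsmul_mem lB 3) using 1
  abel

/-- `6•[□, 1/(1+y²+xy)] ≡ 5•[□, 1/(1+xy)]` (`5π²/72`):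
`6Λ[1/(1+y²)] - 5Λ[1] = -6 m3 - 12 m2 + 12 m1 - 6 w3 + 4 w2 + 3 w1`. -/
theorem census₅ : 6 • KZ.of c5.rep - 5 • KZ.of cB.rep ∈ KZ.relations := by
  have hX : 6 • KZ.of lR5.rep - 5 • KZ.of lOne.rep ∈ KZ.relations := by
    have h := sub_mem (sub_mem (sub_mem (add_mem (add_mem (nsmul_mem m1 12) (nsmul_mem w2 4))
      (nsmul_mem w1 3)) (nsmul_mem m3 6)) (nsmul_mem m2 12)) (nsmul_mem w3 6)
    convert h using 1
    abel
  convert sub_mem (add_mem (nsmul_mem l5 6) hX) (nsmul_mem lB 5) using 1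
  abel

/-- `3•[□, 1/(1+y+y²+xy)] ≡ 2•[□, 1/(1+xy)]` (`π²/18`):
`3Λ[1/(1+y+y²)] - 2Λ[1] = -3 m4 + 3 m4' + 6 m2 - 6 m1 + 3 w3 - 2 w2`. -/
theorem census₆ : 3 • KZ.of c6.rep - 2 • KZ.of cB.rep ∈ KZ.relations := by
  have hX : 3 • KZ.of lR6.rep - 2 • KZ.of lOne.rep ∈ KZ.relations := by
    have h := sub_mem (sub_mem (add_mem (add_mem (sub_mem (nsmul_mem m4' 3) (nsmul_mem m4 3))
      (nsmul_mem m2 6)) (nsmul_mem w3 3)) (nsmul_mem m1 6)) (nsmul_mem w2 2)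
    convert h using 1
    abel
  convert sub_mem (add_mem (nsmul_mem l6 3) hX) (nsmul_mem lB 2) using 1
  abel

/-! ### Literal instances of `RationalCubePiKernelSingle` (`m = 2`, `N = 0`) -/

/-- `d₂ = [□, 1/Q₂ - 1/Q_B]` as one fraction. -/
def d2 : RFun 2 := c2.sub cB
/-- `d₃ = [□, 6/Q₃ - 7/Q_B]`. -/
def d3 : RFun 2 := ((const ((6 : ℕ) : ℚ)).mul c3).sub ((const ((7 : ℕ) : ℚ)).mul cB)
/-- `d₄ = [□, 4/Q₄ - 3/Q_B]`. -/
def d4 : RFun 2 := ((const ((4 : ℕ) : ℚ)).mul c4).sub ((const ((3 : ℕ) : ℚ)).mul cB)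
/-- `d₅ = [□, 6/Q₅ - 5/Q_B]`. -/
def d5 : RFun 2 := ((const ((6 : ℕ) : ℚ)).mul c5).sub ((const ((5 : ℕ) : ℚ)).mul cB)
/-- `d₆ = [□, 3/Q₆ - 2/Q_B]`. -/
def d6 : RFun 2 := ((const ((3 : ℕ) : ℚ)).mul c6).sub ((const ((2 : ℕ) : ℚ)).mul cB)

/-- `d2_rel`: auxiliary theorem of the log-fibre calculus for `RationalCubePiKernelSingle` (stmt-26322) — see the module docstring; verbatim from the lens-2 g6 file. -/
theorem d2_rel : KZ.of d2.rep ∈ KZ.relations := by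
  convert add_mem (rel_sub c2 cB) census₂ using 1
  rw [d2]; abel
/-- `d3_rel`: auxiliary theorem of the log-fibre calculus for `RationalCubePiKernelSingle` (stmt-26322) — see the module docstring; verbatim from the lens-2 g6 file. -/
theorem d3_rel : KZ.of d3.rep ∈ KZ.relations := by
  convert add_mem (sub_mem (add_mem (rel_sub ((const ((6 : ℕ) : ℚ)).mul c3)
    ((const ((7 : ℕ) : ℚ)).mul cB)) (rel_constMul 6 c3)) (rel_constMul 7 cB)) census₃ using 1
  rw [d3]; abel
/-- `d4_rel`: auxiliary theorem of the log-fibre calculus for `RationalCubePiKernelSingle` (stmt-26322) — see the module docstring; verbatim from the lens-2 g6 file. -/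
theorem d4_rel : KZ.of d4.rep ∈ KZ.relations := by
  convert add_mem (sub_mem (add_mem (rel_sub ((const ((4 : ℕ) : ℚ)).mul c4)
    ((const ((3 : ℕ) : ℚ)).mul cB)) (rel_constMul 4 c4)) (rel_constMul 3 cB)) census₄ using 1
  rw [d4]; abel
/-- `d5_rel`: auxiliary theorem of the log-fibre calculus for `RationalCubePiKernelSingle` (stmt-26322) — see the module docstring; verbatim from the lens-2 g6 file. -/
theorem d5_rel : KZ.of d5.rep ∈ KZ.relations := by
  convert add_mem (sub_mem (add_mem (rel_sub ((const ((6 : ℕ) : ℚ)).mul c5)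
    ((const ((5 : ℕ) : ℚ)).mul cB)) (rel_constMul 6 c5)) (rel_constMul 5 cB)) census₅ using 1
  rw [d5]; abel
/-- `d6_rel`: auxiliary theorem of the log-fibre calculus for `RationalCubePiKernelSingle` (stmt-26322) — see the module docstring; verbatim from the lens-2 g6 file. -/
theorem d6_rel : KZ.of d6.rep ∈ KZ.relations := by
  convert add_mem (sub_mem (add_mem (rel_sub ((const ((3 : ℕ) : ℚ)).mul c6)
    ((const ((2 : ℕ) : ℚ)).mul cB)) (rel_constMul 3 c6)) (rel_constMul 2 cB)) census₆ using 1
  rw [d6]; abel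

end Census

end Summit.KontsevichZagierPeriods.RootDecompRationalCubeDichotomy.LogFibre

end
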